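/-
Copyright (c) 2026 the pub-hodgecm-mathlib formalisation cell (harness21).  Prover seat hodgecm-mathlib-K2E1-p13 (g4), Track B ∕ K2-LIT, h413 = `stmt-HodgeConjecture-24833`,
R90-TF section S8 «ContSpec-n½», #2 chain (G side), deal S8-R72∕R79∕R88 of R90-CS-plan (g2), (XF)₃ sub-cut C2 (census `R90/S8/CENSUS-XF3.K2E1-p13-g4.md`): D0-χ₃ — the twisted
radial pseudo-Eisenstein series `θ_{f,ψ}` of `U(2,1)_{L∕L⁺}`; the N = 3 twin of ★ D0-χ `K2E1ChiPseudoEisensteinRadialCMTwo` §2 (K2E3-p12), every input ★ at N = 3.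
-/
import Summits.HodgeConjecture.HodgeConjecture.Theorems.K2E1ChiPseudoEisensteinRadialCMTwo          -- ★ D0-χ (K2E3-p12): §1 GENERIC `(F,E,c,N)` toolkit (flat-section disguise, `twistedCoeff`, invariances, cusp vanishing); brings ★ D0
import Summits.HodgeConjecture.HodgeConjecture.Theorems.K2E1ChiEisensteinConstantTermCMThree       -- ★ `borelConstantTerm_eisensteinSeriesU_flatSectionU_cm_three` (SECTION-GENERIC constant term on `U(2,1)`, `Re z > 2`)
import Summits.HodgeConjecture.HodgeConjecture.Theorems.K2E1BorelEisensteinRegularCMThree          -- ★ `continuous_eisensteinSeriesU_flatSectionU_cm_three`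
import Summits.HodgeConjecture.HodgeConjecture.Theorems.K2E1MaassSelbergCMThree                     -- ★ `summable_flatSectionU_cm_three` (Godement CM three)
import Summits.HodgeConjecture.HodgeConjecture.Theorems.K2E1TruncatedEisensteinBoundedCMThree       -- ★ `exists_isCompact_siegel_low_three`; brings ★ `K2E1ReductionTheoryU3`
import Summits.HodgeConjecture.HodgeConjecture.Theorems.K2E1TruncatedEisensteinL2                   -- ★ `exists_bound_low_of_isCompact`
import Summits.HodgeConjecture.HodgeConjecture.Theorems.K2E1BorelCosetsDictionary                 -- ★ `eisensteinSeriesU_eq_tsum_arithmeticBorelQuot` (every rank)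
import Summits.HodgeConjecture.HodgeConjecture.Theorems.K2E1TruncatedEisensteinExplicit            -- ★ `borelHeight_arithmeticBorel_mul` (every rank)
import Literature.NumberTheory.Automorphic.UnitaryGroupBorelHeightBigCell                             -- ★ `borelHeight_mul_borelHeight_le_one_of_not_mem_arithmeticBorel` (N = 3 big cell)
import Literature.NumberTheory.Automorphic.UnitaryGroupIwasawaAdelic                                  -- ★ `exists_mem_borelAdelic_mul_mem_standardMaximalCompactGL_cm_three`
import HarnessLib

/-!
# (XF)₃ C2 = D0-χ₃ — `K2E1ChiPseudoEisensteinRadialCMThree`: THE TWISTED RADIAL PSEUDO-EISENSTEIN SERIES `θ_{f,ψ}(g) = Σ_{γ ∈ B(L⁺)∖G(L⁺)} f(H(γg))·ψ(γg)` OF `U(2,1)_{L∕L⁺}` —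
# summability, continuity, measurability, BOUNDEDNESS and the CONSTANT TERM along `B` (the N = 3 twin of ★ D0-χ §2; the Mellin form of the `w₀`-cell rides with C3)

Track B ∕ K2-LIT, crux h413 = `stmt-HodgeConjecture-24833`, route of record `HCCMUnconditional`; cell `hodgecm-mathlib`, R90-TF programme, section S8 «ContSpec-n½», #2 chain, letter
(XF)₃ of ★ `K2E1ChiPseudoEisensteinFamiliesOrthogonalCMThree` (CLOSURE TARGET R90_CLOSURE_DAG row T2.1; xref E2.G8.R1 (δ)).  THEOREMS ONLY (no `def`, no `instance`, no `notation`,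
no named-fact hypothesis, no `sorry`; default heartbeats); lane `--supports stmt-HodgeConjecture-24833 --as helper` (count-neutral).  Pays no socket (sub-cut C2 of C1–C4).

THE MATHEMATICS ([MoeglinWaldspurger1995] I.2.13, II.1.2, II.1.5, II.1.7; [Garrett2018] §1.8, §2.8, §2.10–§2.11; [Rogawski1990] §7.3).  `G = U(J₃) = quasiSplit L⁺ L c 3`.  For a profile
`f ∈ C_c((0,∞))` and a weight `ψ : G(𝔸) → ℂ` (continuous, bounded; left-`N(𝔸)`- and left-`B(L⁺)`-invariant where stated — e.g. a `(χ₁, χ₂)`-pair-section with `χ₂` automorphic),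
`θ_{f,ψ} = E(f(H)·ψ)` is the Eisenstein sum of the FLAT SECTION `flatSectionU (H^{−3}·f(H)·ψ) 3` (★ D0-χ §1 `comp_borelHeight_mul_eq_flatSectionU`, GENERIC in `N`; exponent `3` puts
us in the `U(2,1)` Godement domain `Re z > 2` — the coefficient `H^{−3}f(H)ψ` is bounded because `f` has compact support in `(0,∞)`, ★ `exists_bound_twistedCoeff`).  Hence, with every
input ★ at N = 3: ABSOLUTE CONVERGENCE (★ `summable_flatSectionU_cm_three`), CONTINUITY (★ `continuous_eisensteinSeriesU_flatSectionU_cm_three`), BOUNDEDNESS on `G(𝔸)` (★ reduction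
theory `reductionTheoryU_three_antidiagonal`, compact low Siegel part ★ `exists_isCompact_siegel_low_three`, cusp vanishing above the cut-off ★ D0-χ §1, `G(L⁺)`-invariance), and
the CONSTANT TERM **`θ_{f,ψ,B}(g) = f(Hg)·ψ(g) + (ν𝓕)⁻¹ • ∫_{N(𝔸)} f(H(w₀ v g))·ψ(w₀ v g) dν(v)`** (★ SECTION-GENERIC `borelConstantTerm_eisensteinSeriesU_flatSectionU_cm_three` at `z = 3`).
* §1 `summable_comp_borelHeight_mul_cm_three`, `continuous_∕measurable_eisensteinSeriesU_comp_borelHeight_mul_cm_three`, **`exists_bound_eisensteinSeriesU_comp_borelHeight_mul_cm_three`**,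
  **`borelConstantTerm_eisensteinSeriesU_comp_borelHeight_mul_cm_three`**.
HONEST SCOPE: the MELLIN FORM of the `w₀`-cell (`∫_N f(H(w₀vg))ψ(w₀vg) dν = (2π)⁻¹∫ f̃(σ₀+iy)·I_ψ(σ₀+iy, g) dy`, N = 2 ★ D0-χ `integral_comp_borelHeight_mul_weylLongU_eq_mellin_cm_two`) is NOT
in this file — it needs the N = 3 Godement integrability of `H(w₀·)^{σ₀}` on `N(𝔸)` (★ `K2E1IntertwiningGrowthU3`) + Fubini and rides with C3 (`K2E1ChiPseudoEisensteinIdeleSplitCMThree`).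
HONEST LABEL: HC_CM is proved only modulo the 7 printed citations (2 remaining named inputs: hLiu418 = `stmt-HodgeConjecture-24832`, h413 = `stmt-HodgeConjecture-24833`) until rung 0
closes; REL ≠ ★ ≠ BUILT; this file asserts no named fact and closes no socket; count-neutral; letter-free.

## References
* [MoeglinWaldspurger1995] C. Mœglin, J.-L. Waldspurger, *Spectral Decomposition and Eisenstein Series* (1995), I.2.13, II.1.2, II.1.5, II.1.7.
* [Garrett2018] P. Garrett, *Modern Analysis of Automorphic Forms by Example* (2018), §1.8, §2.8, §2.10–§2.11.
* [Rogawski1990] J. D. Rogawski, *Automorphic Representations of Unitary Groups in Three Variables* (1990), §7.3 pp. 96–98.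
-/

set_option autoImplicit false
set_option linter.dupNamespace false  -- the mandated namespace repeats the summit's segment (`HodgeConjecture.HodgeConjecture`)

noncomputable section

open MeasureTheory Measure Set Filter Topology Complex NumberField IsDedekindDomain MulAction
open scoped Real NNReal ENNReal ComplexConjugate Pointwise
open Literature.MeasureTheory.Group Literature.NumberTheory
open Literature.NumberTheory.Automorphic Literature.NumberTheory.Automorphic.UnitaryGroup AdelicGroupData
open Literature.NumberTheory.GaloisRepresentations (HeckeCharacter ideleGroup)
open Summit.HodgeConjecture.HodgeConjecture.Cruxes.H413.K2E1BorelEisensteinU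
open Summit.HodgeConjecture.HodgeConjecture.Cruxes.H413.K2E1ChiPseudoEisensteinRadialCMTwo (comp_borelHeight_mul_eq_flatSectionU continuous_twistedCoeff exists_bound_twistedCoeff twistedCoeff_borelU_mul
  eisensteinSeriesU_comp_borelHeight_mul_arithmeticSubgroup_mul comp_borelHeight_mul_arithmeticBorel_mul)
open Summit.HodgeConjecture.HodgeConjecture.Cruxes.H413.K2E1PseudoEisensteinRadialCMTwo (exists_one_le_forall_eq_zero norm_le_of_cover_of_eq_zero)
open Summit.HodgeConjecture.HodgeConjecture.Cruxes.H413.K2E1TruncatedEisensteinL2 (exists_bound_low_of_isCompact)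
open Summit.HodgeConjecture.HodgeConjecture.Cruxes.H413.K2E1BorelCosetsDictionary (eisensteinSeriesU_eq_tsum_arithmeticBorelQuot)
open Summit.HodgeConjecture.HodgeConjecture.Cruxes.H413.K2E1TruncatedEisensteinBoundedCMThree (exists_isCompact_siegel_low_three)
open Summit.HodgeConjecture.HodgeConjecture.Cruxes.H413.K2E1ReductionTheoryU3 (reductionTheoryU_three_antidiagonal)
open Summit.HodgeConjecture.HodgeConjecture.Cruxes.H413.K2E1MaassSelbergCMThree (summable_flatSectionU_cm_three)
open Summit.HodgeConjecture.HodgeConjecture.Cruxes.H413.K2E1BorelEisensteinRegularCMThree (continuous_eisensteinSeriesU_flatSectionU_cm_three)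
open Summit.HodgeConjecture.HodgeConjecture.Cruxes.H413.K2E1ChiEisensteinConstantTermCMThree (borelConstantTerm_eisensteinSeriesU_flatSectionU_cm_three)

namespace Summit.HodgeConjecture.HodgeConjecture.Cruxes.H413.K2E1ChiPseudoEisensteinRadialCMThree

/-! ## §1 The CM pair `(L⁺, L, conj)`, `N = 3`: summability, continuity, boundedness, the constant term -/

section Generic

variable {F E : Type} [Field F] [NumberField F] [Field E] [NumberField E] [Algebra F E] {c : E ≃ₐ[F] E}

/-- **CUSP VANISHING at N = 3**: if `f` vanishes above `T ≥ 1` and below `T⁻¹`, then `θ_{f,ψ}(g) = 0` whenever `H(g) > T` (`ψ` left-`B(F)`-invariant): on the Borel coset `H(γg) = H(g) > T`,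
on the other cosets `H(γg) ≤ H(g)⁻¹ < T⁻¹` (★ big cell `borelHeight_mul_borelHeight_le_one_of_not_mem_arithmeticBorel`, N = 3).  The N = 3 twin of ★ D0-χ
`eisensteinSeriesU_comp_borelHeight_mul_eq_zero_of_lt`. [cite: Garrett2018, §1.8 and §2.3] [cite: MoeglinWaldspurger1995, II.1.2] -/
theorem eisensteinSeriesU_comp_borelHeight_mul_eq_zero_of_lt_three {f : ℝ → ℂ} {T : ℝ≥0} (hT : 1 ≤ T) (hhi : ∀ r : ℝ, (T : ℝ) < r → f r = 0)
    (hlo : ∀ r : ℝ, r < (T : ℝ)⁻¹ → f r = 0)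
    {ψ : (quasiSplit F E c 3).Adelic → ℂ} (hψB : ∀ b ∈ borelU (c : E →+* E) ((StdForm.antidiagonal 3).over E), ∀ x : (quasiSplit F E c 3).Adelic, ψ ((quasiSplit F E c 3).toAdelic b * x) = ψ x)
    {g : (quasiSplit F E c 3).Adelic} (hg : T < borelHeight g) :
    eisensteinSeriesU (fun x : (quasiSplit F E c 3).Adelic => f (borelHeight x : ℝ) * ψ x) g = 0 := by
  rw [eisensteinSeriesU_eq_tsum_arithmeticBorelQuot (comp_borelHeight_mul_arithmeticBorel_mul f hψB) g]
  have hT0 : (0 : ℝ≥0) < T := one_pos.trans_le hT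
  have hg0 : (0 : ℝ≥0) < borelHeight g := hT0.trans hg
  have h0 : ∀ q : Quotient (QuotientGroup.rightRel (arithmeticBorel F E c 3)),
      f (borelHeight (((q.out : (quasiSplit F E c 3).arithmeticSubgroup) : (quasiSplit F E c 3).Adelic) * g) : ℝ) = 0 := by
    intro q
    by_cases hq : q.out ∈ arithmeticBorel F E c 3
    · rw [K2E1TruncatedEisensteinExplicit.borelHeight_arithmeticBorel_mul hq]
      exact hhi _ (by exact_mod_cast hg)
    · refine hlo _ ?_
      have h1 := borelHeight_mul_borelHeight_le_one_of_not_mem_arithmeticBorel hq g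
      have h2 : borelHeight (((q.out : (quasiSplit F E c 3).arithmeticSubgroup) : (quasiSplit F E c 3).Adelic) * g) ≤ (borelHeight g)⁻¹ :=
        (NNReal.le_inv_iff_mul_le hg0.ne').2 h1
      have h3 : ((borelHeight g)⁻¹ : ℝ≥0) < T⁻¹ := inv_strictAnti₀ hT0 hg
      exact_mod_cast h2.trans_lt h3
  simp only [h0, zero_mul, tsum_zero]

end Generic

section CM

variable (L : Type) [Field L] [NumberField L] [IsCMField L]
variable [MeasurableSpace (quasiSplit (↥(maximalRealSubfield L)) L (IsCMField.complexConj L) 3).Adelic] [BorelSpace (quasiSplit (↥(maximalRealSubfield L)) L (IsCMField.complexConj L) 3).Adelic]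

omit [MeasurableSpace (quasiSplit (↥(maximalRealSubfield L)) L (IsCMField.complexConj L) 3).Adelic] [BorelSpace (quasiSplit (↥(maximalRealSubfield L)) L (IsCMField.complexConj L) 3).Adelic] in
/-- **`Σ_{γ ∈ B(F)∖G(F)} f(H(γg))·ψ(γg)` CONVERGES ABSOLUTELY** for `f ∈ C_c((0,∞))` and `ψ` bounded (★ `summable_flatSectionU_cm_three` at `z = 3`). [cite: MoeglinWaldspurger1995, II.1.2 and II.1.5] -/
theorem summable_comp_borelHeight_mul_cm_three {f : ℝ → ℂ} (hfc : Continuous f) (hfs : HasCompactSupport f) (hf0 : tsupport f ⊆ Ioi 0)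
    {ψ : (quasiSplit (↥(maximalRealSubfield L)) L (IsCMField.complexConj L) 3).Adelic → ℂ} {M : ℝ} (hψM : ∀ x, ‖ψ x‖ ≤ M)
    (g : (quasiSplit (↥(maximalRealSubfield L)) L (IsCMField.complexConj L) 3).Adelic) :
    Summable fun q : Quotient (orbitRel ↥(borelU ((IsCMField.complexConj L : L ≃ₐ[↥(maximalRealSubfield L)] L) : L →+* L) ((StdForm.antidiagonal 3).over L))
        ↥(unitaryGroupOfForm ((IsCMField.complexConj L : L ≃ₐ[↥(maximalRealSubfield L)] L) : L →+* L) ((StdForm.antidiagonal 3).over L))) =>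
      f (borelHeight ((quasiSplit (↥(maximalRealSubfield L)) L (IsCMField.complexConj L) 3).toAdelic
          (Quotient.out q : ↥(unitaryGroupOfForm ((IsCMField.complexConj L : L ≃ₐ[↥(maximalRealSubfield L)] L) : L →+* L) ((StdForm.antidiagonal 3).over L))) * g) : ℝ) *
        ψ ((quasiSplit (↥(maximalRealSubfield L)) L (IsCMField.complexConj L) 3).toAdelic
          (Quotient.out q : ↥(unitaryGroupOfForm ((IsCMField.complexConj L : L ≃ₐ[↥(maximalRealSubfield L)] L) : L →+* L) ((StdForm.antidiagonal 3).over L))) * g) := by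
  set φ : (quasiSplit (↥(maximalRealSubfield L)) L (IsCMField.complexConj L) 3).Adelic → ℂ :=
    fun x => ((borelHeight x : ℝ) : ℂ) ^ (-((3 : ℝ) : ℂ)) * f (borelHeight x : ℝ) * ψ x with hφ
  obtain ⟨C, hC⟩ := exists_bound_twistedCoeff (F := ↥(maximalRealSubfield L)) (E := L) (c := IsCMField.complexConj L) (N := 3) hfc hfs hf0 3 hψM
  have hE : ∀ x, f (borelHeight x : ℝ) * ψ x = flatSectionU φ ((3 : ℝ) : ℂ) x := fun x => congrFun (comp_borelHeight_mul_eq_flatSectionU f 3 ψ) x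
  have h2 : 2 < (((3 : ℝ) : ℂ)).re := by rw [ofReal_re]; norm_num
  have h := summable_flatSectionU_cm_three L h2 (φ := φ) hC g
  simp only [← hE] at h
  exact h

omit [MeasurableSpace (quasiSplit (↥(maximalRealSubfield L)) L (IsCMField.complexConj L) 3).Adelic] [BorelSpace (quasiSplit (↥(maximalRealSubfield L)) L (IsCMField.complexConj L) 3).Adelic] in
/-- **`θ_{f,ψ}` IS CONTINUOUS on `U(2,1)(𝔸_{L⁺})`** for `f ∈ C_c((0,∞))`, `ψ` continuous bounded (★ R4a at `z = 3`). [cite: MoeglinWaldspurger1995, II.1.5] [cite: Garrett2018, §2.8] -/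
theorem continuous_eisensteinSeriesU_comp_borelHeight_mul_cm_three {f : ℝ → ℂ} (hfc : Continuous f) (hfs : HasCompactSupport f) (hf0 : tsupport f ⊆ Ioi 0)
    {ψ : (quasiSplit (↥(maximalRealSubfield L)) L (IsCMField.complexConj L) 3).Adelic → ℂ} (hψc : Continuous ψ) {M : ℝ} (hψM : ∀ x, ‖ψ x‖ ≤ M) :
    Continuous (eisensteinSeriesU (fun x : (quasiSplit (↥(maximalRealSubfield L)) L (IsCMField.complexConj L) 3).Adelic => f (borelHeight x : ℝ) * ψ x)) := by
  obtain ⟨C, hC⟩ := exists_bound_twistedCoeff (F := ↥(maximalRealSubfield L)) (E := L) (c := IsCMField.complexConj L) (N := 3) hfc hfs hf0 3 hψM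
  have h2 : 2 < (((3 : ℝ) : ℂ)).re := by rw [ofReal_re]; norm_num
  rw [comp_borelHeight_mul_eq_flatSectionU f 3 ψ]
  exact continuous_eisensteinSeriesU_flatSectionU_cm_three L h2 (continuous_twistedCoeff hfc hf0 3 hψc) hC

/-- `θ_{f,ψ}` is Borel on `U(2,1)(𝔸_{L⁺})`. [cite: MoeglinWaldspurger1995, II.1.5] -/
theorem measurable_eisensteinSeriesU_comp_borelHeight_mul_cm_three {f : ℝ → ℂ} (hfc : Continuous f) (hfs : HasCompactSupport f) (hf0 : tsupport f ⊆ Ioi 0)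
    {ψ : (quasiSplit (↥(maximalRealSubfield L)) L (IsCMField.complexConj L) 3).Adelic → ℂ} (hψc : Continuous ψ) {M : ℝ} (hψM : ∀ x, ‖ψ x‖ ≤ M) :
    Measurable (eisensteinSeriesU (fun x : (quasiSplit (↥(maximalRealSubfield L)) L (IsCMField.complexConj L) 3).Adelic => f (borelHeight x : ℝ) * ψ x)) :=
  (continuous_eisensteinSeriesU_comp_borelHeight_mul_cm_three L hfc hfs hf0 hψc hψM).measurable

omit [MeasurableSpace (quasiSplit (↥(maximalRealSubfield L)) L (IsCMField.complexConj L) 3).Adelic] [BorelSpace (quasiSplit (↥(maximalRealSubfield L)) L (IsCMField.complexConj L) 3).Adelic] in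
/-- **`θ_{f,ψ}` IS BOUNDED ON `U(2,1)(𝔸_{L⁺})`** for `f ∈ C_c((0,∞))`, `ψ` continuous bounded left-`B(L⁺)`-invariant: ★ reduction theory, the compact low part of the Siegel set + continuity below the
cut-off `T` of ★ `exists_one_le_forall_eq_zero`, cusp vanishing above it, `G(L⁺)`-invariance, ★ D0's case split. [cite: MoeglinWaldspurger1995, I.2.13 and II.1.2] [cite: Garrett2018, §1.8 and §2.10–§2.11] -/
theorem exists_bound_eisensteinSeriesU_comp_borelHeight_mul_cm_three {f : ℝ → ℂ} (hfc : Continuous f) (hfs : HasCompactSupport f) (hf0 : tsupport f ⊆ Ioi 0)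
    {ψ : (quasiSplit (↥(maximalRealSubfield L)) L (IsCMField.complexConj L) 3).Adelic → ℂ} (hψc : Continuous ψ) {M : ℝ} (hψM : ∀ x, ‖ψ x‖ ≤ M)
    (hψB : ∀ b ∈ borelU ((IsCMField.complexConj L : L ≃ₐ[↥(maximalRealSubfield L)] L) : L →+* L) ((StdForm.antidiagonal 3).over L), ∀ x : (quasiSplit (↥(maximalRealSubfield L)) L (IsCMField.complexConj L) 3).Adelic,
      ψ ((quasiSplit (↥(maximalRealSubfield L)) L (IsCMField.complexConj L) 3).toAdelic b * x) = ψ x) :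
    ∃ M₁ : ℝ, ∀ g : (quasiSplit (↥(maximalRealSubfield L)) L (IsCMField.complexConj L) 3).Adelic,
      ‖eisensteinSeriesU (fun x : (quasiSplit (↥(maximalRealSubfield L)) L (IsCMField.complexConj L) 3).Adelic => f (borelHeight x : ℝ) * ψ x) g‖ ≤ M₁ := by
  obtain ⟨T, hT, hhi, hlo⟩ := exists_one_le_forall_eq_zero hfs hf0
  obtain ⟨S, ⟨Ω, K, t, ht, hΩ, hΩc, hKc, rfl⟩, hcov⟩ := reductionTheoryU_three_antidiagonal L
  obtain ⟨C, hC, hsub⟩ := exists_isCompact_siegel_low_three (exists_mem_borelAdelic_mul_mem_standardMaximalCompactGL_cm_three L) ht hΩ hΩc hKc T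
  obtain ⟨M₀, hlow⟩ := exists_bound_low_of_isCompact hC hsub (continuous_eisensteinSeriesU_comp_borelHeight_mul_cm_three L hfc hfs hf0 hψc hψM).continuousOn
  exact ⟨max M₀ 0, norm_le_of_cover_of_eq_zero hcov (eisensteinSeriesU_comp_borelHeight_mul_arithmeticSubgroup_mul f hψB) hlow
    (fun g hg => eisensteinSeriesU_comp_borelHeight_mul_eq_zero_of_lt_three hT hhi hlo hψB hg)⟩

/-- **THE CONSTANT TERM OF THE TWISTED RADIAL PSEUDO-EISENSTEIN SERIES**: for a Haar measure `ν` on `N(𝔸_{L⁺})`, a fundamental domain `𝓕` of `N(L⁺)` with compact closure, `f ∈ C_c((0,∞))`,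
`ψ` continuous bounded left-`N(𝔸)`- and left-`B(L⁺)`-invariant, and every `g`:
**`θ_{f,ψ,B}(g) = f(Hg)·ψ(g) + (ν𝓕)⁻¹ • ∫_{N(𝔸)} f(H(w₀ v g))·ψ(w₀ v g) dν(v)`** — the SECTION-GENERIC ★ `borelConstantTerm_eisensteinSeriesU_flatSectionU_cm_three` at `z = 3` with coefficient
`H^{−3}·(f∘H)·ψ`. [cite: MoeglinWaldspurger1995, II.1.7] [cite: Garrett2018, §2.8] -/
theorem borelConstantTerm_eisensteinSeriesU_comp_borelHeight_mul_cm_three (ν : Measure ↥(adelicUnipotent (↥(maximalRealSubfield L)) L (IsCMField.complexConj L) 3)) [ν.IsHaarMeasure]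
    {𝓕 : Set ↥(adelicUnipotent (↥(maximalRealSubfield L)) L (IsCMField.complexConj L) 3)}
    (h𝓕N : IsFundamentalDomain ↥(rationalUnipotent (↥(maximalRealSubfield L)) L (IsCMField.complexConj L) 3) 𝓕 ν) (h𝓕c : IsCompact (closure 𝓕))
    {f : ℝ → ℂ} (hfc : Continuous f) (hfs : HasCompactSupport f) (hf0 : tsupport f ⊆ Ioi 0)
    {ψ : (quasiSplit (↥(maximalRealSubfield L)) L (IsCMField.complexConj L) 3).Adelic → ℂ} (hψc : Continuous ψ) {M : ℝ} (hψM : ∀ x, ‖ψ x‖ ≤ M)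
    (hψN : ∀ (u : ↥(adelicUnipotent (↥(maximalRealSubfield L)) L (IsCMField.complexConj L) 3)) (x : (quasiSplit (↥(maximalRealSubfield L)) L (IsCMField.complexConj L) 3).Adelic),
      ψ ((u : (quasiSplit (↥(maximalRealSubfield L)) L (IsCMField.complexConj L) 3).Adelic) * x) = ψ x)
    (hψB : ∀ b ∈ borelU ((IsCMField.complexConj L : L ≃ₐ[↥(maximalRealSubfield L)] L) : L →+* L) ((StdForm.antidiagonal 3).over L), ∀ x : (quasiSplit (↥(maximalRealSubfield L)) L (IsCMField.complexConj L) 3).Adelic,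
      ψ ((quasiSplit (↥(maximalRealSubfield L)) L (IsCMField.complexConj L) 3).toAdelic b * x) = ψ x)
    (g : (quasiSplit (↥(maximalRealSubfield L)) L (IsCMField.complexConj L) 3).Adelic) :
    borelConstantTerm ν 𝓕 (eisensteinSeriesU (fun x : (quasiSplit (↥(maximalRealSubfield L)) L (IsCMField.complexConj L) 3).Adelic => f (borelHeight x : ℝ) * ψ x)) g =
      f (borelHeight g : ℝ) * ψ g + ((ν 𝓕).toReal⁻¹ : ℝ) • ∫ v : ↥(adelicUnipotent (↥(maximalRealSubfield L)) L (IsCMField.complexConj L) 3),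
        f ((borelHeight ((quasiSplit (↥(maximalRealSubfield L)) L (IsCMField.complexConj L) 3).toAdelic (weylLongU ((IsCMField.complexConj L : L ≃ₐ[↥(maximalRealSubfield L)] L) : L →+* L) (rfl : (StdForm.antidiagonal 3).over L = (StdForm.antidiagonal 3).over L)) *
          (v : (quasiSplit (↥(maximalRealSubfield L)) L (IsCMField.complexConj L) 3).Adelic) * g)) : ℝ) *
        ψ ((quasiSplit (↥(maximalRealSubfield L)) L (IsCMField.complexConj L) 3).toAdelic (weylLongU ((IsCMField.complexConj L : L ≃ₐ[↥(maximalRealSubfield L)] L) : L →+* L) (rfl : (StdForm.antidiagonal 3).over L = (StdForm.antidiagonal 3).over L)) *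
          (v : (quasiSplit (↥(maximalRealSubfield L)) L (IsCMField.complexConj L) 3).Adelic) * g) ∂ν := by
  set φ : (quasiSplit (↥(maximalRealSubfield L)) L (IsCMField.complexConj L) 3).Adelic → ℂ :=
    fun x => ((borelHeight x : ℝ) : ℂ) ^ (-((3 : ℝ) : ℂ)) * f (borelHeight x : ℝ) * ψ x with hφ
  obtain ⟨C, hC⟩ := exists_bound_twistedCoeff (F := ↥(maximalRealSubfield L)) (E := L) (c := IsCMField.complexConj L) (N := 3) hfc hfs hf0 3 hψM
  have hE : ∀ x, f (borelHeight x : ℝ) * ψ x = flatSectionU φ ((3 : ℝ) : ℂ) x := fun x => congrFun (comp_borelHeight_mul_eq_flatSectionU f 3 ψ) x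
  have h2 : 2 < (((3 : ℝ) : ℂ)).re := by rw [ofReal_re]; norm_num
  have hφN : ∀ (u : ↥(adelicUnipotent (↥(maximalRealSubfield L)) L (IsCMField.complexConj L) 3)) (x : (quasiSplit (↥(maximalRealSubfield L)) L (IsCMField.complexConj L) 3).Adelic),
      φ ((u : (quasiSplit (↥(maximalRealSubfield L)) L (IsCMField.complexConj L) 3).Adelic) * x) = φ x := fun u x => by
    simp only [hφ, borelHeight_unipotent_mul u.2, hψN u x]
  have h := borelConstantTerm_eisensteinSeriesU_flatSectionU_cm_three L ν h𝓕N h𝓕c (φ := φ) (continuous_twistedCoeff hfc hf0 3 hψc) hC hφN (twistedCoeff_borelU_mul f 3 hψB) h2 g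
  rw [← comp_borelHeight_mul_eq_flatSectionU f 3 ψ] at h
  exact h


end CM

end Summit.HodgeConjecture.HodgeConjecture.Cruxes.H413.K2E1ChiPseudoEisensteinRadialCMThree

end
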